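import Summits.BirchSwinnertonDyer.BirchSwinnertonDyer.Theorems.UniversalToricDescentWildSplitControlAtThreeOfSerre1967
import Summits.BirchSwinnertonDyer.Rank1Residual.GaloisImage.PropagatedConditionCardEP
import Literature.NumberTheory.EllipticCurves.Serre1967.PotentiallySupersingularNoStableLineProofs
import Literature.NumberTheory.EllipticCurves.AnticyclotomicPrimeDecompositionSplitProofs
import Literature.NumberTheory.EllipticCurves.AnticyclotomicPrimeDecompositionAboveProofs
import Literature.NumberTheory.GaloisRepresentations.NumberFieldCdTwoProofs
import HarnessLib

/-!
# Route `UniversalToricDescent`, crux #5 `WildSplitControlAtThree` (item stmt-BirchSwinnertonDyer-20386)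
# modulo POITOU–TATE ONLY: five of the seven published-fact inputs are tree theorems

Seat `bsd-wall-utd-p3`, gen 5 (cell `bsd-wall`, lane 3 UTD). Thin BY-NAME closer in the route's import
cone. Gen 17 of `bsd-potss-kmc` closed crux #5 from SEVEN named facts
(`UniversalToricDescentControl.wildSplitControlAtThree_of_facts_of_serre1967`; leaves 20461–20467 of the
gen-1 split). Five of them are now THEOREMS of the tree: the local Euler–Poincaré characteristic
(`EP.localEulerPoincareCharacteristic_adicCompletion`, item 20463), `cd_p ≤ 2` for number fields
(`fieldCdLE_two_of_numberField_holds`, 20464), Brink Thm 2 and Cor 1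
(`ZpExtension.decomp_not_le_kerSubgroup_of_isAnticyclotomic_holds`,
`ZpExtension.decomp_not_le_kerSubgroup_above_of_isAnticyclotomic_holds`, 20465/20466) and — new this
generation — Serre 1967 §5 Prop. 8 (`Serre1967.noStableDivisibleLine_of_potentiallySupersingular_holds`,
20467). Substituting them leaves crux #5 conditional on exactly the two Poitou–Tate facts (items 20461,
20462): `wildSplitControlAtThree_of_poitouTate`.

HONEST FRAMING: CONDITIONAL (two named-fact hypotheses: Poitou–Tate duality for Selmer structures and for
`Ш`); closes nothing by itself; BSD is not proved by any of this.

References: [JetchevSkinnerWan2017] Thm. 3.3.1, Prop. 3.3.4; [MilneADT2006] I 2.8, 4.10; [Brink2007] Thm. 2,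
Cor. 1; [Serre1967GroupesPDivisibles] §5 Prop. 8; [Kolyvagin1990] Thm. A; [GrossLMS1991] §2.
-/

noncomputable section

open scoped Classical

open WeierstrassCurve NumberField IsDedekindDomain Field Literature.NumberTheory.EllipticCurves
  Literature.NumberTheory.EllipticCurves.GreenbergSelmer
  Literature.NumberTheory.GaloisRepresentations
  Literature.NumberTheory.GaloisCohomology
  Literature.NumberTheory.EllipticCurves.Rank1Residual
  Summit.BirchSwinnertonDyer.Rank1Residual.Additive
  Summit.BirchSwinnertonDyer.BirchSwinnertonDyer.Theorems.PotentiallySupersingularLocalTorsion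

set_option linter.dupNamespace false

namespace Summit.BirchSwinnertonDyer.BirchSwinnertonDyer.Theorems.UniversalToricDescentControl

/-- **Crux #5 of route `UniversalToricDescent` BY NAME (`Theses.UniversalToricDescent.WildSplitControlAtThree`,
item stmt-BirchSwinnertonDyer-20386) modulo the two POITOU–TATE facts only**: Poitou–Tate duality for
Selmer structures and `Ш¹(T) ≃ Ш²(T^D)^∨` over number fields. The other five inputs of
`wildSplitControlAtThree_of_facts_of_serre1967` are supplied by tree theorems: the local Euler–Poincaré
characteristic (`EP.localEulerPoincareCharacteristic_adicCompletion`), `cd_p ≤ 2`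
(`fieldCdLE_two_of_numberField_holds`), Brink Thm 2 / Cor 1
(`ZpExtension.decomp_not_le_kerSubgroup_of_isAnticyclotomic_holds`,
`ZpExtension.decomp_not_le_kerSubgroup_above_of_isAnticyclotomic_holds`) and Serre 1967 §5 Prop. 8
(`Serre1967.noStableDivisibleLine_of_potentiallySupersingular_holds`). CONDITIONAL (two named-fact
hypotheses); closes nothing by itself; BSD is not proved by any of this.
[cite: JetchevSkinnerWan2017, Thm. 3.3.1, Prop. 3.3.4 (arXiv:1512.06894 pp. 11–13)]
[cite: MilneADT2006, Ch. I, Thm. 4.10 and Thm. 2.8] [cite: Brink2007, Thm. 2 and Cor. 1]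
[cite: Serre1967GroupesPDivisibles, §5 Prop. 8] -/
theorem wildSplitControlAtThree_of_poitouTate
    (hPT : ∀ (K : Type) [Field K] [NumberField K], poitouTate_selmerStructure_duality K)
    (hPT2 : ∀ (K : Type) [Field K] [NumberField K], poitouTate_sha_tateDual K) :
    Summit.BirchSwinnertonDyer.BirchSwinnertonDyer.Theses.UniversalToricDescent.WildSplitControlAtThree :=
  wildSplitControlAtThree_of_facts_of_serre1967 hPT hPT2
    (fun K _ _ v ↦
      Summit.BirchSwinnertonDyer.Rank1Residual.GaloisImage.EP.localEulerPoincareCharacteristic_adicCompletion K v)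
    fieldCdLE_two_of_numberField_holds
    (fun K _ _ p _ ↦ ZpExtension.decomp_not_le_kerSubgroup_of_isAnticyclotomic_holds K p)
    (fun K _ _ p _ ↦ ZpExtension.decomp_not_le_kerSubgroup_above_of_isAnticyclotomic_holds K p)
    Serre1967.noStableDivisibleLine_of_potentiallySupersingular_holds

end Summit.BirchSwinnertonDyer.BirchSwinnertonDyer.Theorems.UniversalToricDescentControl

end
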